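import Summits.Ventures.CertifiedManyBodySolver.Observables.SourcedGibbsTrialCap
import HarnessLib

/-!
# A SOURCED CAP for the pinning-field bracket (II): the double occupancy of the free pinned Gibbs state
# (Gaudin / Wick) and the assembled HARTREE–FOCK–BCS cap in one-body form (finite torus, exact)

HONEST FRAMING: zero compute; every statement is a PROVED finite-volume identity / inequality; no number is
claimed; the cap's evaluation (certified free-BdG one-body sums at `(U, n, h_tree) = (2, 7/8, 0.2)`, large `β`) is
pilot / hubbard-upper work (cell `hubbard-cq` ruling W4); a sourced cap feeds the FLOOR edge of the Hellmann–Feynman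
bracket (`Observables/PinningFieldResponseBracketDWave.lean`); not a statement about order of the source-free model;
not a superconductivity verdict.

Cell `hubbard-obs` (D-0042 / D-0082 (c-2)), seat `hubbard-obs-pin-2` (`prover-hubbard-obs-pin-2-g0-0`); sequel of
`Observables/SourcedGibbsTrialCap.lean` (§1–§3: Gibbs trial states, the cap with free thermal expectations, transport
to the Nambu picture).

## Contents

* §4 `numberOp_mul_numberOp_eq_wordOp` (`n_{x↑}n_{x↓} = c†_{x↑}c†_{x↓}c_{x↓}c_{x↑}` is Gaudin's nested word),
  `gibbsState_docc_of_conj`: for Nambu data `(𝓗, c)` with `W A Wᴴ = dΓ(𝓗) − c·1`, `F = (1 + e^{β𝓗})⁻¹`,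
  `⟨n_{x↑}n_{x↓}⟩_{β,A} = F_{x↑,x↑}(1 − F_{x↓,x↓}) + F_{x↓,x↑}F_{x↑,x↓}` (`W n↑n↓ Wᴴ = n↑ − n↑n↓` and Gaudin's
  determinant `⟨c†↑c†↓c↓c↑⟩ = F↑↑F↓↓ − F↓↑F↑↓`, `gibbsState_dGamma_nestedWord`); the last term is the squared on-site
  ANOMALOUS amplitude (it vanishes for the `d`-wave field by the `x ↔ y` reflection symmetry — not used here; it is
  kept as an explicit, certifiable one-body term).
* §5 `dWaveSource_free_conj_nambu` (the concrete Nambu data of the `d`-wave pinned torus, `c = μ'L²`),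
  `isHermitian_dWaveNambu`, the GENERIC cap `groundEnergy_le_HFBCS_of_conj` (any finite lattice, any `A' = A + a·N + U·D` with
  `W A Wᴴ = dΓ(𝓗) − c·1`), and the PUBLIC torus cap
  `groundEnergy_dWaveSourceTorus_le_HFBCS` (library instances of the concrete torus — plugs into the `hcap` slots of
  `PinningFieldResponseBracketDWave` / `SourcedOrderParameterFloor` without conversion):
  `E₀(A_L(U,μ,h)) ≤ Re(Σ_{ij} 𝓗_{ij}F_{ji} − μ'L²) + (μ'−μ)·Re Σ_x (F_{x↑,x↑} + 1 − F_{x↓,x↓})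
                   + U·Re Σ_x (F_{x↑,x↑}(1 − F_{x↓,x↓}) + F_{x↓,x↑}F_{x↑,x↓})` for every `β`, `μ'`
  — Bach–Lieb–Solovej's generalized Hartree–Fock energy of the free pinned Gibbs state as an UPPER bound for the
  interacting pinned problem. What remains for a NUMBER: block-diagonalise the translation-invariant `𝓗` in
  momentum space (`2 × 2` Nambu blocks), certify the three per-site sums (interval arithmetic), choose `(β, μ')`.

References: V. Bach, E. H. Lieb, J. P. Solovej, J. Stat. Phys. 76 (1994) 3, §2 eqs. (2c.8)–(2c.10) (quasi-free
expectation of the pair interaction) [BachLiebSolovej1994]; M. Gaudin, Nucl. Phys. 15 (1960) 89 (thermal Wick theorem)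
[Gaudin1960]; E. H. Lieb, PRL 62 (1989) 1201, proof of Thm 2 [Lieb1989]; O. Bratteli, D. W. Robinson, *OAQSM 2* (1997)
§5.2.4 [BratteliRobinsonII1997].
-/

noncomputable section

namespace Summit.Ventures.CertifiedManyBodySolver.Observables

open Matrix Literature.MathematicalPhysics.QuantumLattice Literature.Probability.LatticeModels
open Literature.MathematicalPhysics.QuantumLattice.HubbardWave0
open Literature.Barriers.HubbardSuperconductivity (IsDensityMatrix)
open scoped ComplexOrder BigOperators

/-! ### §4 The double occupancy of the free pinned Gibbs state (Gaudin / Wick) -/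

section Docc

variable {Λ : Type*} [LinearOrder Λ] [Fintype Λ]

/-- `n_{x↑} n_{x↓} = c†_{x↑} c†_{x↓} c_{x↓} c_{x↑}` is Gaudin's nested word of length two on `(x↑, x↓)`.
[cite: Gaudin1960] -/
theorem numberOp_mul_numberOp_eq_wordOp (x : Λ) :
    numberOp x 0 * numberOp x 1 = wordOp (nestedWord 2 ![orb x 0, orb x 1] ![orb x 0, orb x 1]) := by
  have hne : orb x (0 : Fin 2) ≠ orb x 1 := fun h => absurd (orb_eq_orb_iff.1 h).2 (by decide)
  have h1 : annihilation (orb x 0) * creation (orb x 1) =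
      -(creation (orb x 1) * annihilation (orb x 0) : Matrix (Finset (Orb Λ)) (Finset (Orb Λ)) ℂ) := by
    rw [annihilation_mul_creation, if_neg hne, zero_sub]
  have h2 : annihilation (orb x 0) * annihilation (orb x 1) =
      -(annihilation (orb x 1) * annihilation (orb x 0) : Matrix (Finset (Orb Λ)) (Finset (Orb Λ)) ℂ) :=
    eq_neg_of_add_eq_zero_left (annihilation_anticommute_holds (orb x (0 : Fin 2)) (orb x 1))
  have key : numberOp x 0 * numberOp x 1 =
      creation (orb x 0) * creation (orb x 1) * (annihilation (orb x 1) * annihilation (orb x 0)) := by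
    calc numberOp x 0 * numberOp x 1
        = creation (orb x 0) * (annihilation (orb x 0) * creation (orb x 1)) * annihilation (orb x 1) := by
          simp only [numberOp, Matrix.mul_assoc]
      _ = -(creation (orb x 0) * creation (orb x 1) * (annihilation (orb x 0) * annihilation (orb x 1))) := by
          rw [h1]; simp only [Matrix.mul_neg, Matrix.neg_mul, Matrix.mul_assoc]
      _ = creation (orb x 0) * creation (orb x 1) * (annihilation (orb x 1) * annihilation (orb x 0)) := by
          rw [h2, Matrix.mul_neg, neg_neg]
  rw [key]
  simp [nestedWord, wordOp_cons, letterOp, List.ofFn_succ, Fin.rev, Matrix.mul_assoc]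

/-- **Double occupancy of the free pinned Gibbs state** (under the hypotheses of `gibbsState_eq_nambu_of_conj`, `𝓗`
Hermitian): `⟨n_{x↑}n_{x↓}⟩_{β,A} = F_{x↑,x↑}(1 − F_{x↓,x↓}) + F_{x↓,x↑}·F_{x↑,x↓}`
(`W n↑n↓ Wᴴ = n↑ − n↑n↓`; Gaudin's determinant `⟨c†↑c†↓c↓c↑⟩ = F↑↑F↓↓ − F↓↑F↑↓`). The last term is the squared on-site
anomalous amplitude. [cite: Gaudin1960] [cite: BachLiebSolovej1994, §2] -/
theorem gibbsState_docc_of_conj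
    {A : Matrix (Finset (Orb Λ)) (Finset (Orb Λ)) ℂ}
    {𝓗 : Matrix (Orb Λ) (Orb Λ) ℂ} (h𝓗 : 𝓗.IsHermitian) {c : ℂ}
    (hA : partialParticleHole (spinDownOrbitals : Finset (Orb Λ)) * A *
      (partialParticleHole (spinDownOrbitals : Finset (Orb Λ)))ᴴ = dGamma 𝓗 - c • 1)
    (β : ℝ) (x : Λ) :
    gibbsState β A (numberOp x 0 * numberOp x 1) =
      (1 + NormedSpace.exp ((β : ℂ) • 𝓗))⁻¹ (orb x 0) (orb x 0) *
          (1 - (1 + NormedSpace.exp ((β : ℂ) • 𝓗))⁻¹ (orb x 1) (orb x 1)) +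
        (1 + NormedSpace.exp ((β : ℂ) • 𝓗))⁻¹ (orb x 1) (orb x 0) *
          (1 + NormedSpace.exp ((β : ℂ) • 𝓗))⁻¹ (orb x 0) (orb x 1) := by
  set F : Matrix (Orb Λ) (Orb Λ) ℂ := (1 + NormedSpace.exp ((β : ℂ) • 𝓗))⁻¹ with hF
  -- transport: `W n↑n↓ Wᴴ = n↑ (1 − n↓) = n↑ − n↑n↓`
  have hconj : partialParticleHole (spinDownOrbitals : Finset (Orb Λ)) * (numberOp x 0 * numberOp x 1) *
      (partialParticleHole (spinDownOrbitals : Finset (Orb Λ)))ᴴ =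
      numberOp x 0 - numberOp x 0 * numberOp x 1 := by
    rw [partialParticleHole_conj_mul, partialParticleHole_conj_numberOp_up, partialParticleHole_conj_numberOp_down,
      Matrix.mul_sub, Matrix.mul_one]
  -- the two Gibbs moments of `dΓ(𝓗)`
  have h1 : gibbsState β (dGamma 𝓗) (numberOp x 0) = F (orb x 0) (orb x 0) := by
    rw [numberOp]; exact thermalCorr_dGamma_creation_annihilation h𝓗 β (orb x 0) (orb x 0)
  have h2 : gibbsState β (dGamma 𝓗) (numberOp x 0 * numberOp x 1) =
      F (orb x 0) (orb x 0) * F (orb x 1) (orb x 1) - F (orb x 1) (orb x 0) * F (orb x 0) (orb x 1) := by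
    rw [numberOp_mul_numberOp_eq_wordOp, gibbsState_dGamma_nestedWord h𝓗, Matrix.det_fin_two]
    simp only [Matrix.of_apply, Matrix.cons_val_zero, Matrix.cons_val_one]
    have hc : ∀ i j : Orb Λ, gibbsState β (dGamma 𝓗) (creation i * annihilation j) = F j i :=
      fun i j => thermalCorr_dGamma_creation_annihilation h𝓗 β i j
    rw [hc, hc, hc, hc]
  rw [gibbsState_eq_nambu_of_conj hA, hconj, map_sub, h1, h2]
  ring

end Docc

/-! ### §5 The assembled Hartree–Fock–BCS cap in one-body form -/

section HFBCS

variable {Λ : Type*} [LinearOrder Λ] [Fintype Λ]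

/-- **Generalized-Hartree–Fock cap, GENERIC form.** Let `A' = A + a·N + U·Σ_x n_{x↑}n_{x↓}` with `A`, `A'` Hermitian
(the interacting pinned Hamiltonian `A'` versus a free pinned trial Hamiltonian `A` at a shifted chemical potential,
`a = μ' − μ`), and let `W A Wᴴ = dΓ(𝓗) − c·1` with `𝓗` Hermitian (Nambu data of `A`). Then for every real `β`, with
`F = (1 + e^{β𝓗})⁻¹`:
`E₀(A') ≤ Re(Σ_{ij} 𝓗_{ij}F_{ji} − c) + a·Re Σ_x (F_{x↑,x↑} + 1 − F_{x↓,x↓}) + U·Re Σ_x (F_{x↑,x↑}(1 − F_{x↓,x↓}) + F_{x↓,x↑}F_{x↑,x↓})`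
(Gibbs trial state of `A` + §3–§4). Any finite lattice, any pair field, any hopping.
[cite: BachLiebSolovej1994, §2] [cite: Gaudin1960] [cite: Lieb1989, proof of Theorem 2] -/
theorem groundEnergy_le_HFBCS_of_conj {A A' : Matrix (Finset (Orb Λ)) (Finset (Orb Λ)) ℂ} (hA' : A'.IsHermitian)
    (hAh : A.IsHermitian) {a U : ℝ}
    (hdec : A' = A + (a : ℂ) • totalNumber + (U : ℂ) • ∑ x : Λ, numberOp x 0 * numberOp x 1)
    {𝓗 : Matrix (Orb Λ) (Orb Λ) ℂ} (h𝓗 : 𝓗.IsHermitian) {c : ℂ}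
    (hA : partialParticleHole (spinDownOrbitals : Finset (Orb Λ)) * A *
      (partialParticleHole (spinDownOrbitals : Finset (Orb Λ)))ᴴ = dGamma 𝓗 - c • 1) (β : ℝ) :
    A'.groundEnergy ≤
      ((∑ i : Orb Λ, ∑ j : Orb Λ, 𝓗 i j * (1 + NormedSpace.exp ((β : ℂ) • 𝓗))⁻¹ j i) - c).re +
        a * (∑ x : Λ,
          ((1 + NormedSpace.exp ((β : ℂ) • 𝓗))⁻¹ (orb x 0) (orb x 0) +
            (1 - (1 + NormedSpace.exp ((β : ℂ) • 𝓗))⁻¹ (orb x 1) (orb x 1)))).re +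
        U * (∑ x : Λ,
          ((1 + NormedSpace.exp ((β : ℂ) • 𝓗))⁻¹ (orb x 0) (orb x 0) *
              (1 - (1 + NormedSpace.exp ((β : ℂ) • 𝓗))⁻¹ (orb x 1) (orb x 1)) +
            (1 + NormedSpace.exp ((β : ℂ) • 𝓗))⁻¹ (orb x 1) (orb x 0) *
              (1 + NormedSpace.exp ((β : ℂ) • 𝓗))⁻¹ (orb x 0) (orb x 1))).re := by
  haveI : Nonempty (Finset (Orb Λ)) := ⟨∅⟩
  have hle := groundEnergy_le_re_gibbsState β hA' hAh
  have hexp : gibbsState β A A' = gibbsState β A A + (a : ℂ) * gibbsState β A totalNumber +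
      (U : ℂ) * gibbsState β A (∑ x : Λ, numberOp x 0 * numberOp x 1) := by
    rw [hdec, map_add, map_add, LinearMap.map_smul_of_tower, LinearMap.map_smul_of_tower, smul_eq_mul, smul_eq_mul]
  have e3 : gibbsState β A (∑ x : Λ, numberOp x 0 * numberOp x 1) =
      ∑ x : Λ, ((1 + NormedSpace.exp ((β : ℂ) • 𝓗))⁻¹ (orb x 0) (orb x 0) *
            (1 - (1 + NormedSpace.exp ((β : ℂ) • 𝓗))⁻¹ (orb x 1) (orb x 1)) +
          (1 + NormedSpace.exp ((β : ℂ) • 𝓗))⁻¹ (orb x 1) (orb x 0) *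
            (1 + NormedSpace.exp ((β : ℂ) • 𝓗))⁻¹ (orb x 0) (orb x 1)) := by
    rw [map_sum]
    exact Finset.sum_congr rfl fun x _ => gibbsState_docc_of_conj h𝓗 hA β x
  rw [hexp, gibbsState_self_of_conj h𝓗 hA, gibbsState_totalNumber_of_conj h𝓗 hA, e3, Complex.add_re, Complex.add_re,
    Complex.re_ofReal_mul, Complex.re_ofReal_mul] at hle
  exact hle

end HFBCS

/-! ### §5′ The public statement (library instances of the concrete torus) -/

section Public

variable (L : ℕ) [NeZero L]

/-- **The concrete Nambu data of the free `d`-wave pinned torus**: `W A_L(0,μ',h) Wᴴ = dΓ(𝓗_{L,μ',h}) − μ'L²·1`,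
`𝓗_{L,μ',h} = bdgNambuMatrix τ_L Δ_{L,h} μ'` (`partialParticleHole_conj_dWaveSourceTorus` at `U = 0`).
[cite: Lieb1989, proof of Theorem 2] -/
theorem dWaveSource_free_conj_nambu (μ' h : ℝ) :
    partialParticleHole (spinDownOrbitals : Finset (Orb (FermionTorus 2 L))) * dWaveSourceTorus L 0 μ' h *
        (partialParticleHole (spinDownOrbitals : Finset (Orb (FermionTorus 2 L))))ᴴ =
      dGamma (bdgNambuMatrix
          (fun x y => if (fermionTorusGraph 2 L).Adj x y then -(1 : ℂ) else 0)
          (fun u v : FermionTorus 2 L => -(h : ℂ) * ∑ i : Fin 2,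
            if v = FermionTorus.ofTorusSite (u.toTorusSite + Pi.single i 1) then
              ((Real.sqrt 2 * (if i = 0 then 1 else -1) : ℝ) : ℂ) else 0) μ') -
        ((μ' : ℂ) * (L : ℂ) ^ 2) • (1 : Matrix (Finset (Orb (FermionTorus 2 L))) (Finset (Orb (FermionTorus 2 L))) ℂ) := by
  rw [partialParticleHole_conj_dWaveSourceTorus, Complex.ofReal_zero, zero_smul, add_zero]

/-- The Nambu matrix of the `d`-wave pinned torus is Hermitian. [cite: BachLiebSolovej1994, §2] -/
theorem isHermitian_dWaveNambu (μ' h : ℝ) :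
    (bdgNambuMatrix
        (fun x y => if (fermionTorusGraph 2 L).Adj x y then -(1 : ℂ) else 0)
        (fun u v : FermionTorus 2 L => -(h : ℂ) * ∑ i : Fin 2,
          if v = FermionTorus.ofTorusSite (u.toTorusSite + Pi.single i 1) then
            ((Real.sqrt 2 * (if i = 0 then 1 else -1) : ℝ) : ℂ) else 0) μ').IsHermitian := by
  refine isHermitian_bdgNambuMatrix (fun x y => ?_) _ μ'
  by_cases hxy : (fermionTorusGraph 2 L).Adj x y
  · rw [if_pos hxy, if_pos hxy.symm, star_neg, star_one]
  · have hyx : ¬ (fermionTorusGraph 2 L).Adj y x := fun h' => hxy h'.symm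
    rw [if_neg hxy, if_neg hyx, star_zero]

/-- **Hartree–Fock–BCS sourced cap for the `d`-wave pinned Hubbard torus (finite torus, exact; library instances).**
With the Nambu matrix `𝓗 = 𝓗_{L,μ',h}` of the free `d`-wave pinned torus (`dWaveSource_free_conj_nambu`),
`F = (1 + e^{β𝓗})⁻¹`, any `β` and any trial `μ'`:
`E₀(A_L(U,μ,h)) ≤ Re(Σ_{ij} 𝓗_{ij}F_{ji} − μ'L²) + (μ'−μ)·Re Σ_x (F_{x↑,x↑} + 1 − F_{x↓,x↓})
                 + U·Re Σ_x (F_{x↑,x↑}(1 − F_{x↓,x↓}) + F_{x↓,x↑}F_{x↑,x↓})`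
— the generalized-Hartree–Fock energy of the free pinned Gibbs state bounds the interacting pinned ground energy;
a SOURCED CAP for the Hellmann–Feynman floor edge once the three one-body sums are certified (plugs into the `hcap`
slots of `PinningFieldResponseBracketDWave` / obsth-3's `SourcedOrderParameterFloor` at a fixed `L`).
[cite: BachLiebSolovej1994, §2] [cite: Gaudin1960] [cite: Lieb1989, proof of Theorem 2] -/
theorem groundEnergy_dWaveSourceTorus_le_HFBCS (U μ μ' h β : ℝ) :
    (dWaveSourceTorus L U μ h).groundEnergy ≤
      ((∑ i : Orb (FermionTorus 2 L), ∑ j : Orb (FermionTorus 2 L),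
          (bdgNambuMatrix
              (fun x y => if (fermionTorusGraph 2 L).Adj x y then -(1 : ℂ) else 0)
              (fun u v : FermionTorus 2 L => -(h : ℂ) * ∑ i : Fin 2,
                if v = FermionTorus.ofTorusSite (u.toTorusSite + Pi.single i 1) then
                  ((Real.sqrt 2 * (if i = 0 then 1 else -1) : ℝ) : ℂ) else 0) μ') i j *
            (1 + NormedSpace.exp ((β : ℂ) • bdgNambuMatrix
              (fun x y => if (fermionTorusGraph 2 L).Adj x y then -(1 : ℂ) else 0)
              (fun u v : FermionTorus 2 L => -(h : ℂ) * ∑ i : Fin 2,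
                if v = FermionTorus.ofTorusSite (u.toTorusSite + Pi.single i 1) then
                  ((Real.sqrt 2 * (if i = 0 then 1 else -1) : ℝ) : ℂ) else 0) μ'))⁻¹ j i) -
          (μ' : ℂ) * (L : ℂ) ^ 2).re +
        (μ' - μ) * (∑ x : FermionTorus 2 L,
          ((1 + NormedSpace.exp ((β : ℂ) • bdgNambuMatrix
              (fun x y => if (fermionTorusGraph 2 L).Adj x y then -(1 : ℂ) else 0)
              (fun u v : FermionTorus 2 L => -(h : ℂ) * ∑ i : Fin 2,
                if v = FermionTorus.ofTorusSite (u.toTorusSite + Pi.single i 1) then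
                  ((Real.sqrt 2 * (if i = 0 then 1 else -1) : ℝ) : ℂ) else 0) μ'))⁻¹ (orb x 0) (orb x 0) +
            (1 - (1 + NormedSpace.exp ((β : ℂ) • bdgNambuMatrix
              (fun x y => if (fermionTorusGraph 2 L).Adj x y then -(1 : ℂ) else 0)
              (fun u v : FermionTorus 2 L => -(h : ℂ) * ∑ i : Fin 2,
                if v = FermionTorus.ofTorusSite (u.toTorusSite + Pi.single i 1) then
                  ((Real.sqrt 2 * (if i = 0 then 1 else -1) : ℝ) : ℂ) else 0) μ'))⁻¹ (orb x 1) (orb x 1)))).re +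
        U * (∑ x : FermionTorus 2 L,
          ((1 + NormedSpace.exp ((β : ℂ) • bdgNambuMatrix
              (fun x y => if (fermionTorusGraph 2 L).Adj x y then -(1 : ℂ) else 0)
              (fun u v : FermionTorus 2 L => -(h : ℂ) * ∑ i : Fin 2,
                if v = FermionTorus.ofTorusSite (u.toTorusSite + Pi.single i 1) then
                  ((Real.sqrt 2 * (if i = 0 then 1 else -1) : ℝ) : ℂ) else 0) μ'))⁻¹ (orb x 0) (orb x 0) *
              (1 - (1 + NormedSpace.exp ((β : ℂ) • bdgNambuMatrix
              (fun x y => if (fermionTorusGraph 2 L).Adj x y then -(1 : ℂ) else 0)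
              (fun u v : FermionTorus 2 L => -(h : ℂ) * ∑ i : Fin 2,
                if v = FermionTorus.ofTorusSite (u.toTorusSite + Pi.single i 1) then
                  ((Real.sqrt 2 * (if i = 0 then 1 else -1) : ℝ) : ℂ) else 0) μ'))⁻¹ (orb x 1) (orb x 1)) +
            (1 + NormedSpace.exp ((β : ℂ) • bdgNambuMatrix
              (fun x y => if (fermionTorusGraph 2 L).Adj x y then -(1 : ℂ) else 0)
              (fun u v : FermionTorus 2 L => -(h : ℂ) * ∑ i : Fin 2,
                if v = FermionTorus.ofTorusSite (u.toTorusSite + Pi.single i 1) then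
                  ((Real.sqrt 2 * (if i = 0 then 1 else -1) : ℝ) : ℂ) else 0) μ'))⁻¹ (orb x 1) (orb x 0) *
              (1 + NormedSpace.exp ((β : ℂ) • bdgNambuMatrix
              (fun x y => if (fermionTorusGraph 2 L).Adj x y then -(1 : ℂ) else 0)
              (fun u v : FermionTorus 2 L => -(h : ℂ) * ∑ i : Fin 2,
                if v = FermionTorus.ofTorusSite (u.toTorusSite + Pi.single i 1) then
                  ((Real.sqrt 2 * (if i = 0 then 1 else -1) : ℝ) : ℂ) else 0) μ'))⁻¹ (orb x 0) (orb x 1))).re := by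
  have key := groundEnergy_le_HFBCS_of_conj (Λ := FermionTorus 2 L)
    (dWaveSourceTorus_isHermitian L (isHermitian_hubbardTorusWith L 1 U μ) h)
    (dWaveSourceTorus_isHermitian L (isHermitian_hubbardTorusWith L 1 0 μ') h)
    (dWaveSourceTorus_eq_free_add L U μ μ' h) (isHermitian_dWaveNambu L μ' h)
    (c := (μ' : ℂ) * (L : ℂ) ^ 2) (by
      -- the library `DecidableEq` of the concrete torus versus the `LinearOrder`-derived one of the generic lemma
      convert dWaveSource_free_conj_nambu L μ' h using 7) β
  convert key using 40

end Public


end Summit.Ventures.CertifiedManyBodySolver.Observables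

end
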